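import Summits.QuantumFields.BalabanUV.Beta.FP.SecondOrderTableEvenPart
import Summits.QuantumFields.BalabanUV.Beta.FP.TowerNParityRows
import Summits.QuantumFields.BalabanUV.Beta.FP.TowerNParityRowsW
import Summits.QuantumFields.BalabanUV.Beta.FP.CompositeOneShotChartParity
import Summits.QuantumFields.BalabanUV.Beta.NVertexParities
import Summits.QuantumFields.BalabanUV.Beta.NVertexSectors

/-!
# `BalabanUV.Beta.FP.TowerNParityRowsEven` — road «FP» for binder row D1, ROUTE T (β1), RULING R-FP-80: **THE END WRAPPER's N ROWS FOR THE EVEN HALF `WN♮` OF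
# THE RECORD's SECOND-ORDER FAMILY — `hWN ∕ hWNm ∕ hWNt` AS THEOREMS, the even blocks `hHN₂ ∕ hQN₂` read, and the conversion `hessKer (AN) (V) (WN♮) = hessKer (AN) (V) (WN)`**
# (companion of `TowerNParityRows` p469880 ∕ `TowerNParityRowsW` p470214; the N-block of the v4 recipe `g40/SPEC-51.md` §C as terms over `fN ∕ hmN`)

WHY.  The v3 END wrapper `StepRecursionFeedNestedNamedB` (p405971 ✓) displays for the record's `WN (Roots.ctr Lc) Pn (n+1)` the rows `hWN` (decay), `hWNm` (no `μμ` block),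
`hWNt` (ANTI-twin border), `hHN₂ ∕ hQN₂` (content on `Ŵ|ff ∕ Ŵ|μf`).  `hWNt` is NOT inhabited by the literal (Engine C WNTWIN «MIXED»; the GAN24 lane's
`oddHalf_W2SymOfK`: the odd half is the response word); R-FP-80 feeds the even half `WN♮ μ y ν y′ := ½•(WN … μ y ν y′ + sgnK (trK (WN … μ y ν y′)))` instead, for which
EVERY displayed N row is a theorem and the END's `hessKer` is unchanged.  THIS FILE states them in the wrapper's exact shapes: §1 record letters — the swap symmetry of `WN`
(an2 PART 13 `WN_eq_W2SymOfK` + lit `W2SymOfK_swap`) and `Spr (AN R j)` (an2 `NVertexSectors.decays_AN`); §2 **`exists_NN_rows_even`** (`hVN ∕ hWN♮ ∕ hδN` with `NN n = Lc^(n+2)`: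
`TowerNParityRows.exists_NN_rows`' data + GAN24 `vertexFamily₂_evenHalf_of_swap` — SAME constants), **`hWNm_rows_even`** (`TowerNParityRowsW.hWNm_rows` through
`SecondOrderTableEvenPart.perF_dper_evenHalf_mm`), **`hWNt_rows_even`** (`perF_dper_evenHalf_antitwin_fμ` — the seventh row, now a theorem), the even blocks
`WN_even_submatrix_ff ∕ WN_even_submatrix_μf` (what the v4 rows `hHN₂ ∕ hQN₂` display on their right); §3 **`hessKer_WN_even`**: `hessKer (AN R j) V (WN R P j)♮ = hessKer (AN R j) V (WN R P j)`
(`SecondOrderTableEvenPart.hessKer_evenHalf` at `spr_AN` + leaf-03 O-3 `CompositeOneShotChartParity.trK_AN`) — so END-Comp's `htr` row is met by the v3 conclusion VERBATIM.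
[folklore] instantiation BY NAME; no `def`, no `def … : Prop`, nothing cited, 0 sorry; 0 estimates.  NOT HERE: the v4 wrapper; the F∕G twins (displayed families — the instantiation
feeds even halves and uses `SecondOrderTableEvenPart` directly; G's conversion is `trK_GcombSh`); `hHN₂ ∕ hQN₂` themselves (content rows, the (C1) instantiation's).

HONEST DEPENDENCY (page 1, mandatory): continuum YM on T⁴ ⇐ BetaPertH ∧ nine spine estimates (0/9 proved); BetaPertH ⇐ (D1) ∧ (D4) ∧ CAP+tail;
G-an2-4 gates asym, D1 and NE2/3/4.  HONEST FRAMING (cell contract, verbatim): «discharging `BetaPertH` makes Bałaban's UV stability UNCONDITIONAL —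
a real constructive-QFT result; it is NOT the continuum limit and NOT the Clay problem.»  ABSOLUTE RULE (cell charter, verbatim): «No internally-minted
statement may enter as a cited fact. Every hypothesis is either kernel-proved in this package or a verbatim quotation of a PUBLISHED theorem with page
reference. The manuscript(s) under audit are NOT citable for their own disputed steps — they are the thing under adjudication; programme-internal
(2001/route/tribunal) claims are never citable.»  Nothing of the dictionary's identification ∕ Bałaban's asserted; 0∕4 row-D1 binders (hW, hR, D1Tel, D1Rep); ROOT M‴
p325680 untouched; NOT (C1), NOT (T-ID), NOT SDF, NOT D1, NOT BetaPertH, NOT continuum, NOT Clay.  Road «FP» OWNER, b2b-balaban-beta-d1-p3 gen 40, 2026-08-27.  No existing file touched.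
-/

noncomputable section

open scoped BigOperators

namespace Summit.QuantumFields.BalabanUV.Beta.FP.TowerNParityRowsEven

open Literature.MathematicalPhysics.QuantumFieldTheory.Balaban1983to89 Literature.MathematicalPhysics.QuantumFieldTheory.Balaban1983to89.Beta
open B5Prop11Plancherel (fine)  open B6Lemma24Torus (pbox)
open AffineAveraging (Site)  open ExpKernelCalculus (MKer VertexFamily VertexFamily₂ hessKer)  open OneStepResolventKernel (Fib)
open SecondOrderResponse (W2SymOfK_swap)
open Summit.QuantumFields.BalabanUV.Beta.TameKernelCalculus (Spr trK)
open Summit.QuantumFields.BalabanUV.Beta.BorderedHessian (sgnK)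
open Summit.QuantumFields.BalabanUV.Beta.CompositeOneShotJetData (Roots Pins AN VN WN)
open Summit.QuantumFields.BalabanUV.Beta.NVertexSectors (decays_AN)
open Summit.QuantumFields.BalabanUV.Beta.NVertexParities (vertexFamilies_VN_WN)
open Summit.QuantumFields.BalabanUV.Beta.NVertexParitiesW (WN_eq_W2SymOfK)
open Summit.QuantumFields.BalabanUV.Beta.GAN24.SecondOrderCarrierParity (vertexFamily₂_evenHalf_of_swap)
open Summit.QuantumFields.BalabanUV.Beta.FP.KernelPeriodisationFib (Idx perF)
open Summit.QuantumFields.BalabanUV.Beta.FP.KernelPeriodisationFibLoc (dper)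
open Summit.QuantumFields.BalabanUV.Beta.FP.TorusCompositeObjects (towerTorus)
open Summit.QuantumFields.BalabanUV.Beta.FP.TowerNParityRows (exists_NN_rows)
open Summit.QuantumFields.BalabanUV.Beta.FP.TowerNParityRowsW (hWNm_rows)
open Summit.QuantumFields.BalabanUV.Beta.FP.CompositeOneShotChartParity (trK_AN)
open Summit.QuantumFields.BalabanUV.Beta.FP.SecondOrderTableEvenPart (hessKer_evenHalf perF_dper_evenHalf_mm perF_dper_evenHalf_antitwin_fμ
  perF_dper_evenHalf_submatrix_ff perF_dper_evenHalf_submatrix_μf)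

/-! ## §1 Record letters: `WN` is swap-symmetric; the N chart is spread -/

section Record

variable {Lc : ℕ} [NeZero Lc] (R : Roots Lc) (P : Pins) (j : ℕ)

/-- [folklore] **`WN_swap`**: the record's second-order family is swap-symmetric in its two coarse sources (`WN = W2SymOfK …`, an2 PART 13; lit `W2SymOfK_swap`). -/
theorem WN_swap (μ : Fin (3 + 1)) (y : Site (3 + 1)) (ν : Fin (3 + 1)) (y' : Site (3 + 1)) : WN R P j ν y' μ y = WN R P j μ y ν y' := by
  rw [WN_eq_W2SymOfK]
  exact W2SymOfK_swap _ _ _ _ _ _ μ y ν y'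

/-- [folklore] **`spr_AN`**: the one-shot N chart is spread (an2 `NVertexSectors.decays_AN`). -/
theorem spr_AN : Spr (AN R j) := by
  obtain ⟨δ, C, hδ, -, h⟩ := decays_AN R j
  exact ⟨C, δ, hδ, h⟩

/-- [folklore] a member of the record's second-order family is bi-localised at its two coarse bonds with a NONNEGATIVE constant and a positive rate. -/
theorem exists_biLoc_WN (μ : Fin (3 + 1)) (y : Site (3 + 1)) (ν : Fin (3 + 1)) (y' : Site (3 + 1)) :
    ∃ C δ : ℝ, 0 ≤ C ∧ 0 < δ ∧ ExpKernelCalculus.BiLoc (WN R P j μ y ν y') (((Lc ^ (j + 1) : ℕ) : ℤ) • y) (((Lc ^ (j + 1) : ℕ) : ℤ) • y') C δ := by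
  obtain ⟨Cv, Cw, δ, hδ, -, hW⟩ := vertexFamilies_VN_WN R P j
  exact ⟨Cw, δ, (hW μ y ν y').nonneg (Sum.inl 0), hδ, hW μ y ν y'⟩

end Record

/-! ## §2 The wrapper's N rows for the even half `WN♮` (shapes VERBATIM, `WN … μ y ν y′` replaced by `½•(WN … μ y ν y′ + sgnK (trK (WN … μ y ν y′)))`) -/

section Rows

variable {Lc : ℕ} [NeZero Lc] (Mc : ℕ → (Fin (3 + 1) → ℕ)) (Pn : Pins)
  (fN : ∀ n : ℕ, ∀ B : ℕ, (↥(pbox (Mc B)) × Fin (3 + 1)) → Idx (towerTorus Lc (fine Lc (Mc B)) (n + 1)) (Fib 3))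
  (hmN : ∀ n : ℕ, ∀ B : ℕ, ∀ a : (↥(pbox (Mc B)) × Fin (3 + 1)), ∃ m : Fin (3 + 1), ((fN n) B a).2 = Sum.inr m)
-- the wrapper's `[∀ B μ, NeZero (Mc B μ)]` (l.114) is assumed from `hWNm_rows_even` on (the torus lemmas periodise sums)

/-- [folklore] **`exists_NN_rows_even` — THE WRAPPER's `hVN ∕ hWN ∕ hδN` ROWS WITH THE EVEN SECOND-ORDER FAMILY**: the data of `TowerNParityRows.exists_NN_rows` serve
`WN♮` with the SAME constants (GAN24 `vertexFamily₂_evenHalf_of_swap` at `WN_swap`). -/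
theorem exists_NN_rows_even : ∃ (NN : ℕ → ℕ) (CvN CwN δN : ℕ → ℝ),
    (∀ n : ℕ, VertexFamily (VN (Roots.ctr Lc) Pn (n + 1)) (NN n) (CvN n) (δN n))
      ∧ (∀ n : ℕ, VertexFamily₂ (fun μ y ν y' => (1 / 2 : ℝ) • (WN (Roots.ctr Lc) Pn (n + 1) μ y ν y' + sgnK (trK (WN (Roots.ctr Lc) Pn (n + 1) μ y ν y'))))
          (NN n) (CwN n) (δN n))
      ∧ (∀ n : ℕ, 0 < δN n) ∧ (∀ n : ℕ, NN n = Lc ^ (n + 1 + 1)) := by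
  obtain ⟨NN, CvN, CwN, δN, hV, hW, hδ, hNN⟩ := exists_NN_rows (Lc := Lc) Pn
  exact ⟨NN, CvN, CwN, δN, hV, fun n => vertexFamily₂_evenHalf_of_swap (fun μ y ν y' => WN_swap (Roots.ctr Lc) Pn (n + 1) μ y ν y') (hW n), hδ, hNN⟩

variable [∀ B μ, NeZero (Mc B μ)]

include hmN in
/-- [folklore] **`hWNm_rows_even` — THE WRAPPER's `hWNm` ROW FOR `WN♮`** (`TowerNParityRowsW.hWNm_rows` through `SecondOrderTableEvenPart.perF_dper_evenHalf_mm`). -/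
theorem hWNm_rows_even :
    ∀ (n : ℕ) (μ : Fin (3 + 1)) (y : Fin (3 + 1) → ℤ) (ν : Fin (3 + 1)) (y' : Fin (3 + 1) → ℤ), ∀ B : ℕ, ∀ a a' : (↥(pbox (Mc B)) × Fin (3 + 1)),
    (perF (towerTorus Lc (fine Lc (Mc B)) (n + 1)) (dper (towerTorus Lc (fine Lc (Mc B)) (n + 1))
        ((1 / 2 : ℝ) • (WN (Roots.ctr Lc) Pn (n + 1) μ y ν y' + sgnK (trK (WN (Roots.ctr Lc) Pn (n + 1) μ y ν y')))))) (((fN n) B) a) (((fN n) B) a') = 0 := by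
  intro n μ y ν y' B a a'
  obtain ⟨C, δ, hC, hδ, hW⟩ := exists_biLoc_WN (Roots.ctr Lc) Pn (n + 1) μ y ν y'
  exact perF_dper_evenHalf_mm _ ((fN n) B) hW hC hδ (fun a a' => hWNm_rows Mc Pn fN hmN n μ y ν y' B a a') a a'

include hmN in
/-- [folklore] **`hWNt_rows_even` — THE WRAPPER's SEVENTH N ROW `hWNt`, A THEOREM FOR `WN♮`** (R-FP-80: for the record's `WN` itself it is NOT inhabited — WNTWIN «MIXED» ∕
GAN24 `oddHalf_W2SymOfK`; for the even half it holds by construction, `SecondOrderTableEvenPart.perF_dper_evenHalf_antitwin_fμ`). -/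
theorem hWNt_rows_even :
    ∀ (n : ℕ) (μ : Fin (3 + 1)) (y : Fin (3 + 1) → ℤ) (ν : Fin (3 + 1)) (y' : Fin (3 + 1) → ℤ), ∀ B : ℕ,
    ∀ (b : (↥(pbox (towerTorus Lc (fine Lc (Mc B)) (n + 1))) × Fin (3 + 1))) (a : (↥(pbox (Mc B)) × Fin (3 + 1))),
    (perF (towerTorus Lc (fine Lc (Mc B)) (n + 1)) (dper (towerTorus Lc (fine Lc (Mc B)) (n + 1))
        ((1 / 2 : ℝ) • (WN (Roots.ctr Lc) Pn (n + 1) μ y ν y' + sgnK (trK (WN (Roots.ctr Lc) Pn (n + 1) μ y ν y')))))) (b.1, Sum.inl b.2) (((fN n) B) a)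
      = -(perF (towerTorus Lc (fine Lc (Mc B)) (n + 1)) (dper (towerTorus Lc (fine Lc (Mc B)) (n + 1))
        ((1 / 2 : ℝ) • (WN (Roots.ctr Lc) Pn (n + 1) μ y ν y' + sgnK (trK (WN (Roots.ctr Lc) Pn (n + 1) μ y ν y')))))) (((fN n) B) a) (b.1, Sum.inl b.2) := by
  intro n μ y ν y' B b a
  obtain ⟨C, δ, hC, hδ, hW⟩ := exists_biLoc_WN (Roots.ctr Lc) Pn (n + 1) μ y ν y'
  exact perF_dper_evenHalf_antitwin_fμ _ ((fN n) B) ((hmN n) B) hW hC hδ b a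

/-- [folklore] **`WN_even_submatrix_ff`** — the right side the v4 row `hHN₂` displays: `Ŵ♮|ff = Matrix.of (b b′ ↦ ½(Ŵ b̃ b̃′ + Ŵ b̃′ b̃))`, `Ŵ := perF T (dper T (WN … μ y ν y′))`. -/
theorem WN_even_submatrix_ff (n : ℕ) (μ : Fin (3 + 1)) (y : Fin (3 + 1) → ℤ) (ν : Fin (3 + 1)) (y' : Fin (3 + 1) → ℤ) (B : ℕ) :
    (perF (towerTorus Lc (fine Lc (Mc B)) (n + 1)) (dper (towerTorus Lc (fine Lc (Mc B)) (n + 1))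
        ((1 / 2 : ℝ) • (WN (Roots.ctr Lc) Pn (n + 1) μ y ν y' + sgnK (trK (WN (Roots.ctr Lc) Pn (n + 1) μ y ν y')))))).submatrix
        (fun b : ↥(pbox (towerTorus Lc (fine Lc (Mc B)) (n + 1))) × Fin (3 + 1) => ((b.1, Sum.inl b.2) : Idx (towerTorus Lc (fine Lc (Mc B)) (n + 1)) (Fib 3)))
        (fun b : ↥(pbox (towerTorus Lc (fine Lc (Mc B)) (n + 1))) × Fin (3 + 1) => ((b.1, Sum.inl b.2) : Idx (towerTorus Lc (fine Lc (Mc B)) (n + 1)) (Fib 3)))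
      = Matrix.of fun b b' : ↥(pbox (towerTorus Lc (fine Lc (Mc B)) (n + 1))) × Fin (3 + 1) =>
          (1 / 2 : ℝ) * ((perF (towerTorus Lc (fine Lc (Mc B)) (n + 1)) (dper (towerTorus Lc (fine Lc (Mc B)) (n + 1)) (WN (Roots.ctr Lc) Pn (n + 1) μ y ν y')))
              (b.1, Sum.inl b.2) (b'.1, Sum.inl b'.2)
            + (perF (towerTorus Lc (fine Lc (Mc B)) (n + 1)) (dper (towerTorus Lc (fine Lc (Mc B)) (n + 1)) (WN (Roots.ctr Lc) Pn (n + 1) μ y ν y')))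
              (b'.1, Sum.inl b'.2) (b.1, Sum.inl b.2)) := by
  obtain ⟨C, δ, hC, hδ, hW⟩ := exists_biLoc_WN (Roots.ctr Lc) Pn (n + 1) μ y ν y'
  exact perF_dper_evenHalf_submatrix_ff _ hW hC hδ

include hmN in
/-- [folklore] **`WN_even_submatrix_μf`** — the right side the v4 row `hQN₂` displays: `Ŵ♮.sub fN e_F = Matrix.of (a b ↦ ½(Ŵ (fN a) b̃ − Ŵ b̃ (fN a)))`. -/
theorem WN_even_submatrix_μf (n : ℕ) (μ : Fin (3 + 1)) (y : Fin (3 + 1) → ℤ) (ν : Fin (3 + 1)) (y' : Fin (3 + 1) → ℤ) (B : ℕ) :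
    (perF (towerTorus Lc (fine Lc (Mc B)) (n + 1)) (dper (towerTorus Lc (fine Lc (Mc B)) (n + 1))
        ((1 / 2 : ℝ) • (WN (Roots.ctr Lc) Pn (n + 1) μ y ν y' + sgnK (trK (WN (Roots.ctr Lc) Pn (n + 1) μ y ν y')))))).submatrix ((fN n) B)
        (fun b : ↥(pbox (towerTorus Lc (fine Lc (Mc B)) (n + 1))) × Fin (3 + 1) => ((b.1, Sum.inl b.2) : Idx (towerTorus Lc (fine Lc (Mc B)) (n + 1)) (Fib 3)))
      = Matrix.of fun (a : ↥(pbox (Mc B)) × Fin (3 + 1)) (b : ↥(pbox (towerTorus Lc (fine Lc (Mc B)) (n + 1))) × Fin (3 + 1)) =>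
          (1 / 2 : ℝ) * ((perF (towerTorus Lc (fine Lc (Mc B)) (n + 1)) (dper (towerTorus Lc (fine Lc (Mc B)) (n + 1)) (WN (Roots.ctr Lc) Pn (n + 1) μ y ν y')))
              (((fN n) B) a) (b.1, Sum.inl b.2)
            - (perF (towerTorus Lc (fine Lc (Mc B)) (n + 1)) (dper (towerTorus Lc (fine Lc (Mc B)) (n + 1)) (WN (Roots.ctr Lc) Pn (n + 1) μ y ν y')))
              (b.1, Sum.inl b.2) (((fN n) B) a)) := by
  obtain ⟨C, δ, hC, hδ, hW⟩ := exists_biLoc_WN (Roots.ctr Lc) Pn (n + 1) μ y ν y'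
  exact perF_dper_evenHalf_submatrix_μf _ ((fN n) B) ((hmN n) B) hW hC hδ

end Rows

/-! ## §3 The conversion at the END: `hessKer (AN) (V) (WN♮) = hessKer (AN) (V) (WN)` -/

section Conversion

variable {Lc : ℕ} [NeZero Lc] (R : Roots Lc) (P : Pins) (j : ℕ)

/-- [folklore] **`hessKer_WN_even` — THE END READS THE SAME KERNEL**: for ANY first-order family `V`, `hessKer (AN R j) V (WN R P j)♮ = hessKer (AN R j) V (WN R P j)`
(`SecondOrderTableEvenPart.hessKer_evenHalf` at `spr_AN` + leaf-03 O-3 `trK_AN` + an2 PART 12's `VertexFamily₂ (WN R P j)`), so END-Comp's `htr` row — stated on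
`hessKer (AN (Roots.ctr Lc) j) (VN …) (WN …)` — is met by the v3 law's conclusion fed with `WN♮`, VERBATIM. -/
theorem hessKer_WN_even (V : Fin (3 + 1) → (Fin (3 + 1) → ℤ) → MKer (3 + 1) (Fib 3)) :
    hessKer (AN R j) V (fun μ y ν y' => (1 / 2 : ℝ) • (WN R P j μ y ν y' + sgnK (trK (WN R P j μ y ν y'))))
      = hessKer (AN R j) V (WN R P j) := by
  obtain ⟨Cv, Cw, δ, hδ, -, hW⟩ := vertexFamilies_VN_WN R P j
  exact hessKer_evenHalf (spr_AN R j) (trK_AN R j) V hW hδ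

end Conversion

end Summit.QuantumFields.BalabanUV.Beta.FP.TowerNParityRowsEven

end
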